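import Mathlib.Analysis.SpecialFunctions.Pow.Deriv
import Literature.Analysis.FluidPDE.ClassicalL2Stability
import HarnessLib

/-!
# Route TypeICertificateLadder — `RungReynoldsOne`, line `lp-vorticity-young-budget`:
# the weighted balance of a jointly smooth field on a closed slab (stub S2)

Stub `stub_weightedVorticityBalance` of the lead's skeleton for the crux `RungReynoldsOne`
(item stmt-NavierStokesRegularity-2882), line `lp-vorticity-young-budget`.

For a field `w : [0, T] × ℝ³ → ℝ³` jointly smooth on the closed slab, bounded (`‖w‖ ≤ B`), with
`∫ ‖w(t)‖² ≤ C₀` and `∫ ‖∂ₜw(t)‖² ≤ C₁` on `[0, T]` (`∂ₜw` the one-sided time derivative within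
`[0, T]`), put, with the smooth convex weight `F(y) = (‖y‖² + 1)^{5/4} − 1`,

* `Φ(t) = ∫ F(w(t, x)) dx` (the weighted mass), and
* `Ψ(t) = (5/2) ∫ (‖w‖² + 1)^{1/4} ⟪w, ∂ₜw⟫ dx` (its production; pointwise
  `d/dt F(w(t, x)) = (5/2)(‖w‖² + 1)^{1/4}⟪w, ∂ₜw⟫` by the chain rule).

Then `Ψ ∈ L¹(0, T)`, `Φ` is continuous on `[0, T]`, and `Φ(b) = Φ(0) + ∫₀ᵇ Ψ` for `b ∈ (0, T]`.

This is the weighted twin of `Literature.Analysis.FluidPDE.IsSmoothSpaceTimeOn.l2_balance`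
(density `‖w‖²` replaced by `F(w)`), and the proof mirrors it step by step: the domination
`|(5/2)(‖w‖²+1)^{1/4}⟪w, ∂ₜw⟫| ≤ (5/4)(B²+1)^{1/4}(‖w‖² + ‖∂ₜw‖²)` makes the density integrable
on `(0, T) × ℝ³` (Tonelli), the elementary inequality `a⁵ − 1 ≤ (5/4) a (a⁴ − 1)` (`a ≥ 1`,
here `a = (‖w‖²+1)^{1/4} ≤ (B²+1)^{1/4}`) gives `0 ≤ F(w) ≤ (5/4)(B²+1)^{1/4}‖w‖²`, so every slice
`F(w(t))` is integrable; then the fundamental theorem of calculus on each time line, Fubini, and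
continuity of the primitive. Everything is folklore calculus; no named facts are used.
-/

noncomputable section

open Set Filter Topology MeasureTheory
open scoped RealInnerProductSpace ENNReal NNReal Laplacian ContDiff
open Literature.Analysis.FluidPDE

namespace Summit.NavierStokesRegularity.NavierStokesRegularity.Theorems.RungReynoldsOne

-- the summit and the problem share the name `NavierStokesRegularity` (tree layout), so the linter
-- fires on every declaration of this namespace
set_option linter.dupNamespace false

/-- The elementary convexity inequality behind `F(y) ≤ (5/4)(‖y‖²+1)^{1/4}‖y‖²`: for `a ≥ 1`,
`a⁵ − 1 ≤ (5/4)·a·(a⁴ − 1)` (indeed `(5/4)a(a⁴−1) − (a⁵−1) = ¼(a−1)²(a³+2a²+3a+4) ≥ 0`).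
[folklore] -/
theorem pow_five_sub_one_le_weighted (a : ℝ) (ha : 1 ≤ a) :
    a ^ 5 - 1 ≤ 5 / 4 * a * (a ^ 4 - 1) := by
  have ha0 : 0 ≤ a := zero_le_one.trans ha
  have hq : 0 ≤ a ^ 3 + 2 * a ^ 2 + 3 * a + 4 := by positivity
  have key : 5 / 4 * a * (a ^ 4 - 1) - (a ^ 5 - 1) =
      1 / 4 * ((a - 1) ^ 2 * (a ^ 3 + 2 * a ^ 2 + 3 * a + 4)) := by ring
  have hnn : 0 ≤ (a - 1) ^ 2 * (a ^ 3 + 2 * a ^ 2 + 3 * a + 4) := mul_nonneg (sq_nonneg _) hq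
  linarith

/-- The fourth power of `ρ^{1/4}` is `ρ` (`ρ ≥ 0`). [folklore] -/
theorem rpow_quarter_pow_four {ρ : ℝ} (hρ : 0 ≤ ρ) : (ρ ^ (1 / 4 : ℝ)) ^ 4 = ρ := by
  rw [← Real.rpow_natCast, ← Real.rpow_mul hρ]
  norm_num

/-- `ρ^{5/4} = (ρ^{1/4})⁵` (`ρ ≥ 0`). [folklore] -/
theorem rpow_five_quarters_eq {ρ : ℝ} (hρ : 0 ≤ ρ) : ρ ^ (5 / 4 : ℝ) = (ρ ^ (1 / 4 : ℝ)) ^ 5 := by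
  rw [← Real.rpow_natCast, ← Real.rpow_mul hρ]
  norm_num

/-- **S2 — the weighted balance of a jointly smooth field on a closed slab** (weighted twin of
`IsSmoothSpaceTimeOn.l2_balance`): for `w` jointly smooth on `[0,T] × ℝ³`, bounded, with
`∫‖w(t)‖² ≤ C₀`, `∫‖∂ₜw(t)‖² ≤ C₁` (one-sided time derivative within `[0,T]`), the weighted mass
`Φ(t) = ∫((|w|²+1)^{5/4} − 1)` and its production `Ψ(t) = (5/2)∫(|w|²+1)^{1/4}⟪w, ∂ₜw⟫` satisfy:
`Ψ ∈ L¹(0,T)`, `Φ` continuous on `[0,T]`, `Φ(b) = Φ(0) + ∫₀ᵇ Ψ` (`b ∈ (0,T]`). Pointwise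
`d/dt F(w) = (5/2)(|w|²+1)^{1/4}⟪w,∂ₜw⟫`, domination `|·| ≤ (5/4)(B²+1)^{1/4}(|w|² + |∂ₜw|²)`,
`F(w) ≤ (5/4)(B²+1)^{1/4}|w|²`, FTC in `t` per `x`, Fubini. [folklore] -/
theorem stub_weightedVorticityBalance :
    ∀ ⦃T : ℝ⦄, 0 < T → ∀ ⦃w : ℝ → EuclideanSpace ℝ (Fin 3) → EuclideanSpace ℝ (Fin 3)⦄,
      IsSmoothSpaceTimeOn (Icc 0 T) w →
    ∀ ⦃C₀ C₁ : ℝ≥0⦄ ⦃B : ℝ⦄,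
      (∀ t ∈ Icc 0 T, ∫⁻ x, ‖w t x‖ₑ ^ 2 ≤ C₀) →
      (∀ t ∈ Icc 0 T, ∫⁻ x, ‖timeDerivWithin (Icc 0 T) w t x‖ₑ ^ 2 ≤ C₁) →
      (∀ t ∈ Icc 0 T, ∀ x, ‖w t x‖ ≤ B) →
      IntegrableOn (fun t => ∫ x, 5 / 2 * ((‖w t x‖ ^ 2 + 1) ^ (1 / 4 : ℝ) *
          ⟪w t x, timeDerivWithin (Icc 0 T) w t x⟫)) (Ioo 0 T) ∧
      ContinuousOn (fun t => ∫ x, ((‖w t x‖ ^ 2 + 1) ^ (5 / 4 : ℝ) - 1)) (Icc 0 T) ∧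
      ∀ b ∈ Ioc 0 T, ∫ x, ((‖w b x‖ ^ 2 + 1) ^ (5 / 4 : ℝ) - 1) =
        (∫ x, ((‖w 0 x‖ ^ 2 + 1) ^ (5 / 4 : ℝ) - 1)) +
          ∫ t in (0 : ℝ)..b, ∫ x, 5 / 2 * ((‖w t x‖ ^ 2 + 1) ^ (1 / 4 : ℝ) *
            ⟪w t x, timeDerivWithin (Icc 0 T) w t x⟫) := by
  intro T hT w hw C₀ C₁ B hC₀ hC₁ hB
  have hU : UniqueDiffOn ℝ (Icc 0 T) := uniqueDiffOn_Icc hT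
  set W : ℝ → EuclideanSpace ℝ (Fin 3) → EuclideanSpace ℝ (Fin 3) :=
    timeDerivWithin (Icc 0 T) w with hW
  have hWsm : IsSmoothSpaceTimeOn (Icc 0 T) W := hw.timeDerivWithin hU
  have cw : ContinuousOn (Function.uncurry w) (Icc 0 T ×ˢ univ) := hw.continuousOn
  have cW : ContinuousOn (Function.uncurry W) (Icc 0 T ×ˢ univ) := hWsm.continuousOn
  -- the density `g`, the weight `Fw` and the weighted mass `E` (opaque, with equations)
  obtain ⟨g, hg⟩ : ∃ g : ℝ → EuclideanSpace ℝ (Fin 3) → ℝ,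
      g = fun t x => 5 / 2 * ((‖w t x‖ ^ 2 + 1) ^ (1 / 4 : ℝ) * ⟪w t x, W t x⟫) := ⟨_, rfl⟩
  obtain ⟨Fw, hFw⟩ : ∃ Fw : ℝ → EuclideanSpace ℝ (Fin 3) → ℝ,
      Fw = fun t x => (‖w t x‖ ^ 2 + 1) ^ (5 / 4 : ℝ) - 1 := ⟨_, rfl⟩
  obtain ⟨E, hE⟩ : ∃ E : ℝ → ℝ, E = fun t => ∫ x, ((‖w t x‖ ^ 2 + 1) ^ (5 / 4 : ℝ) - 1) :=
    ⟨_, rfl⟩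
  have hgt : ∀ t x, g t x = 5 / 2 * ((‖w t x‖ ^ 2 + 1) ^ (1 / 4 : ℝ) * ⟪w t x, W t x⟫) :=
    fun t x => by rw [hg]
  have hFwt : ∀ t x, Fw t x = (‖w t x‖ ^ 2 + 1) ^ (5 / 4 : ℝ) - 1 := fun t x => by rw [hFw]
  have hEt : ∀ t, E t = ∫ x, Fw t x := fun t => by rw [hE, hFw]
  have hEt' : ∀ t, E t = ∫ x, ((‖w t x‖ ^ 2 + 1) ^ (5 / 4 : ℝ) - 1) := fun t => by rw [hE]
  -- joint continuity
  have cρ : ContinuousOn (fun z : ℝ × EuclideanSpace ℝ (Fin 3) => ‖w z.1 z.2‖ ^ 2 + 1)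
      (Icc 0 T ×ˢ univ) := ((cw.norm).pow 2).add continuousOn_const
  have cρ4 : ContinuousOn (fun z : ℝ × EuclideanSpace ℝ (Fin 3) =>
      (‖w z.1 z.2‖ ^ 2 + 1) ^ (1 / 4 : ℝ)) (Icc 0 T ×ˢ univ) :=
    cρ.rpow_const fun z _ => Or.inr (by norm_num)
  have cρ5 : ContinuousOn (fun z : ℝ × EuclideanSpace ℝ (Fin 3) =>
      (‖w z.1 z.2‖ ^ 2 + 1) ^ (5 / 4 : ℝ)) (Icc 0 T ×ˢ univ) :=
    cρ.rpow_const fun z _ => Or.inr (by norm_num)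
  have cg : ContinuousOn (Function.uncurry g) (Icc 0 T ×ˢ univ) := by
    rw [hg]; exact continuousOn_const.mul (cρ4.mul (cw.inner cW))
  have cF : ContinuousOn (Function.uncurry Fw) (Icc 0 T ×ˢ univ) := by
    rw [hFw]; exact cρ5.sub continuousOn_const
  -- slices
  have cwt : ∀ t ∈ Icc 0 T, Continuous (w t) := fun t ht => (hw.contDiff_slice ht).continuous
  have cWt : ∀ t ∈ Icc 0 T, Continuous (W t) := fun t ht => (hWsm.contDiff_slice ht).continuous
  have hw_lt : ∀ t ∈ Icc 0 T, ∫⁻ x, ‖w t x‖ₑ ^ 2 < ⊤ := fun t ht =>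
    (hC₀ t ht).trans_lt ENNReal.coe_lt_top
  -- the constants `K = (B²+1)^{1/4} ≥ 1` and `L = (5/4) K`
  obtain ⟨K, hK⟩ : ∃ K : ℝ, K = (B ^ 2 + 1) ^ (1 / 4 : ℝ) := ⟨_, rfl⟩
  have hK1 : 1 ≤ K := by
    rw [hK]; exact Real.one_le_rpow (by nlinarith [sq_nonneg B]) (by norm_num)
  have hK0 : 0 ≤ K := zero_le_one.trans hK1
  obtain ⟨L, hL⟩ : ∃ L : ℝ, L = 5 / 4 * K := ⟨_, rfl⟩
  have hL0 : 0 ≤ L := by rw [hL]; positivity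
  have hρ0 : ∀ t x, 0 ≤ ‖w t x‖ ^ 2 + 1 := fun t x => by positivity
  have hρ1 : ∀ t x, 1 ≤ (‖w t x‖ ^ 2 + 1) ^ (1 / 4 : ℝ) := fun t x =>
    Real.one_le_rpow (by nlinarith [sq_nonneg ‖w t x‖]) (by norm_num)
  have hρK : ∀ t ∈ Icc 0 T, ∀ x, (‖w t x‖ ^ 2 + 1) ^ (1 / 4 : ℝ) ≤ K := by
    intro t ht x
    have h2 : ‖w t x‖ ^ 2 ≤ B ^ 2 := pow_le_pow_left₀ (norm_nonneg _) (hB t ht x) 2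
    rw [hK]
    exact Real.rpow_le_rpow (hρ0 t x) (by linarith) (by norm_num)
  -- the weight: `0 ≤ Fw ≤ L ‖w‖²`, continuity and integrability of the slices
  have hF0 : ∀ t x, 0 ≤ Fw t x := fun t x => by
    rw [hFwt]
    exact sub_nonneg.2 (Real.one_le_rpow (by nlinarith [sq_nonneg ‖w t x‖]) (by norm_num))
  have hFle : ∀ t ∈ Icc 0 T, ∀ x, Fw t x ≤ L * ‖w t x‖ ^ 2 := by
    intro t ht x
    have ha1 := hρ1 t x
    have haK := hρK t ht x
    have ha4 := rpow_quarter_pow_four (hρ0 t x)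
    rw [hFwt, rpow_five_quarters_eq (hρ0 t x)]
    generalize (‖w t x‖ ^ 2 + 1) ^ (1 / 4 : ℝ) = a at ha1 haK ha4 ⊢
    have h4 : 0 ≤ a ^ 4 - 1 := sub_nonneg.2 (one_le_pow₀ ha1)
    have hsq : ‖w t x‖ ^ 2 = a ^ 4 - 1 := by rw [ha4]; ring
    calc a ^ 5 - 1 ≤ 5 / 4 * a * (a ^ 4 - 1) := pow_five_sub_one_le_weighted a ha1
      _ ≤ 5 / 4 * K * (a ^ 4 - 1) :=
          mul_le_mul_of_nonneg_right (mul_le_mul_of_nonneg_left haK (by norm_num)) h4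
      _ = L * ‖w t x‖ ^ 2 := by rw [hL, hsq]
  have cFt : ∀ t ∈ Icc 0 T, Continuous (Fw t) := by
    intro t ht
    have h : Continuous fun x => (‖w t x‖ ^ 2 + 1) ^ (5 / 4 : ℝ) - 1 :=
      ((((cwt t ht).norm.pow 2).add continuous_const).rpow_const
        fun x => Or.inr (by norm_num)).sub continuous_const
    refine h.congr fun x => ?_
    rw [hFwt]
  have iF : ∀ t ∈ Icc 0 T, Integrable (Fw t) volume := by
    intro t ht
    refine integrable_of_continuous_of_nonneg (cFt t ht) (hF0 t) ?_
    have hpt : ∀ x, ENNReal.ofReal (Fw t x) ≤ ENNReal.ofReal L * ‖w t x‖ₑ ^ 2 := by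
      intro x
      rw [← ofReal_norm, ← ENNReal.ofReal_pow (norm_nonneg _), ← ENNReal.ofReal_mul hL0]
      exact ENNReal.ofReal_le_ofReal (hFle t ht x)
    calc ∫⁻ x, ENNReal.ofReal (Fw t x) ≤ ∫⁻ x, ENNReal.ofReal L * ‖w t x‖ₑ ^ 2 :=
          lintegral_mono hpt
      _ = ENNReal.ofReal L * ∫⁻ x, ‖w t x‖ₑ ^ 2 :=
          lintegral_const_mul' _ _ ENNReal.ofReal_ne_top
      _ < ⊤ := ENNReal.mul_lt_top ENNReal.ofReal_lt_top (hw_lt t ht)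
  -- pointwise bound `|g| ≤ L (‖w‖² + ‖W‖²)` and integrability of `g` on `(0, T) × ℝ³`
  have hgle : ∀ t ∈ Icc 0 T, ∀ x, ‖g t x‖ ≤ L * (‖w t x‖ ^ 2 + ‖W t x‖ ^ 2) := by
    intro t ht x
    rw [hgt, norm_mul, norm_mul, Real.norm_of_nonneg (by norm_num : (0 : ℝ) ≤ 5 / 2),
      Real.norm_of_nonneg (zero_le_one.trans (hρ1 t x))]
    have h1 : ‖⟪w t x, W t x⟫‖ ≤ ‖w t x‖ * ‖W t x‖ := norm_inner_le_norm (𝕜 := ℝ) _ _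
    have h2 : ‖w t x‖ * ‖W t x‖ ≤ 2⁻¹ * (‖w t x‖ ^ 2 + ‖W t x‖ ^ 2) := by
      nlinarith [sq_nonneg (‖w t x‖ - ‖W t x‖)]
    have h3 : (‖w t x‖ ^ 2 + 1) ^ (1 / 4 : ℝ) * ‖⟪w t x, W t x⟫‖ ≤
        K * (2⁻¹ * (‖w t x‖ ^ 2 + ‖W t x‖ ^ 2)) :=
      mul_le_mul (hρK t ht x) (h1.trans h2) (norm_nonneg _) hK0
    calc 5 / 2 * ((‖w t x‖ ^ 2 + 1) ^ (1 / 4 : ℝ) * ‖⟪w t x, W t x⟫‖)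
        ≤ 5 / 2 * (K * (2⁻¹ * (‖w t x‖ ^ 2 + ‖W t x‖ ^ 2))) :=
          mul_le_mul_of_nonneg_left h3 (by norm_num)
      _ = L * (‖w t x‖ ^ 2 + ‖W t x‖ ^ 2) := by rw [hL]; ring
  have hg_lint : ∀ t ∈ Icc 0 T, ∫⁻ x, ‖g t x‖ₑ ≤ ENNReal.ofReal L * (C₀ + C₁) := by
    intro t ht
    have hpt : ∀ x, ‖g t x‖ₑ ≤ ENNReal.ofReal L * (‖w t x‖ₑ ^ 2 + ‖W t x‖ₑ ^ 2) := by
      intro x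
      have hR : ENNReal.ofReal L * (‖w t x‖ₑ ^ 2 + ‖W t x‖ₑ ^ 2) =
          ENNReal.ofReal (L * (‖w t x‖ ^ 2 + ‖W t x‖ ^ 2)) := by
        rw [ENNReal.ofReal_mul hL0, ENNReal.ofReal_add (sq_nonneg _) (sq_nonneg _),
          ENNReal.ofReal_pow (norm_nonneg _), ENNReal.ofReal_pow (norm_nonneg _), ofReal_norm,
          ofReal_norm]
      rw [hR, ← ofReal_norm]
      exact ENNReal.ofReal_le_ofReal (hgle t ht x)
    calc ∫⁻ x, ‖g t x‖ₑ ≤ ∫⁻ x, ENNReal.ofReal L * (‖w t x‖ₑ ^ 2 + ‖W t x‖ₑ ^ 2) :=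
          lintegral_mono hpt
      _ = ENNReal.ofReal L * ((∫⁻ x, ‖w t x‖ₑ ^ 2) + ∫⁻ x, ‖W t x‖ₑ ^ 2) := by
          rw [lintegral_const_mul' _ _ ENNReal.ofReal_ne_top, lintegral_add_left']
          exact (cwt t ht).aemeasurable.enorm.pow_const _
      _ ≤ ENNReal.ofReal L * (C₀ + C₁) := by
          gcongr
          · exact hC₀ t ht
          · exact hC₁ t ht
  have hKfin : ENNReal.ofReal L * (C₀ + C₁) ≠ ⊤ :=
    ENNReal.mul_ne_top ENNReal.ofReal_ne_top
      (ENNReal.add_ne_top.2 ⟨ENNReal.coe_ne_top, ENNReal.coe_ne_top⟩)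
  have hg_int : ∀ b ∈ Ioc 0 T, Integrable (Function.uncurry g)
      (((volume : Measure ℝ).restrict (Ioo 0 b)).prod volume) := by
    intro b hb
    refine integrable_prod_of_continuousOn_of_lintegral
      (cg.mono (prod_mono (Icc_subset_Icc le_rfl hb.2) Subset.rfl)) ?_
    calc ∫⁻ t in Ioo 0 b, ∫⁻ x, ‖Function.uncurry g (t, x)‖ₑ
        ≤ ∫⁻ _ in Ioo 0 b, ENNReal.ofReal L * (C₀ + C₁) :=
          setLIntegral_mono' measurableSet_Ioo fun t ht =>
            hg_lint t ⟨ht.1.le, ht.2.le.trans hb.2⟩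
      _ < ⊤ := by
          rw [setLIntegral_const]
          exact ENNReal.mul_lt_top hKfin.lt_top (by simp)
  -- the time derivative of `F(w(t, x))` at interior times
  have hderiv : ∀ t ∈ Ioo 0 T, ∀ x, HasDerivAt (fun τ => Fw τ x) (g t x) t := by
    intro t ht x
    have h1 : HasDerivAt (fun τ => w τ x) (W t x) t :=
      (hw.hasDerivWithinAt_timeDerivWithin hU (Ioo_subset_Icc_self ht) x).hasDerivAt
        (Icc_mem_nhds ht.1 ht.2)
    have h2 : HasDerivAt (fun τ => ‖w τ x‖ ^ 2 + 1) (2 * ⟪w t x, W t x⟫) t :=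
      h1.norm_sq.add_const 1
    have h3 := (h2.rpow_const (p := (5 / 4 : ℝ)) (Or.inr (by norm_num))).sub_const (1 : ℝ)
    have h5 : (fun τ => Fw τ x) = fun τ => (‖w τ x‖ ^ 2 + 1) ^ (5 / 4 : ℝ) - 1 :=
      funext fun τ => hFwt τ x
    rw [h5, hgt]
    refine h3.congr_deriv ?_
    rw [show (5 / 4 : ℝ) - 1 = 1 / 4 by norm_num]
    ring
  -- FTC in `t` for each `x`, on `[0, b]`
  have hFTC : ∀ b ∈ Ioc 0 T, ∀ x, ∫ t in (0 : ℝ)..b, g t x = Fw b x - Fw 0 x := by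
    intro b hb x
    have hsub : Icc 0 b ⊆ Icc 0 T := Icc_subset_Icc le_rfl hb.2
    have hc : ContinuousOn (fun τ => ((τ, x) : ℝ × EuclideanSpace ℝ (Fin 3))) (Icc 0 b) :=
      (continuous_id.prodMk continuous_const).continuousOn
    have hmaps : MapsTo (fun τ => ((τ, x) : ℝ × EuclideanSpace ℝ (Fin 3))) (Icc 0 b)
        (Icc 0 T ×ˢ univ) := fun τ hτ => mk_mem_prod (hsub hτ) (mem_univ x)
    have hcont : ContinuousOn (fun τ => Fw τ x) (Icc 0 b) :=
      (cF.comp hc hmaps).congr fun τ _ => rfl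
    have hcg : ContinuousOn (fun τ => g τ x) (Icc 0 b) := (cg.comp hc hmaps).congr fun τ _ => rfl
    exact intervalIntegral.integral_eq_sub_of_hasDerivAt_of_le (f := fun τ => Fw τ x)
      (f' := fun τ => g τ x) hb.1.le hcont (fun t ht => hderiv t ⟨ht.1, ht.2.trans_le hb.2⟩ x)
      (hcg.intervalIntegrable_of_Icc hb.1.le)
  -- Fubini: `E b - E 0 = ∫₀ᵇ ∫ g`
  obtain ⟨φ, hφ⟩ : ∃ φ : ℝ → ℝ, φ = fun t => ∫ x, g t x := ⟨_, rfl⟩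
  have hφt : ∀ t, φ t = ∫ x, g t x := fun t => by rw [hφ]
  have hφ_int : IntegrableOn φ (Ioo 0 T) volume := by
    rw [hφ]; exact (hg_int T ⟨hT, le_rfl⟩).integral_prod_left
  have hEb : ∀ b ∈ Ioc 0 T, E b = E 0 + ∫ t in (0 : ℝ)..b, φ t := by
    intro b hb
    have hI := hg_int b hb
    have hswap := integral_integral_swap (μ := (volume : Measure ℝ).restrict (Ioo 0 b))
      (ν := (volume : Measure (EuclideanSpace ℝ (Fin 3)))) (f := fun t x => g t x) hI
    have hx : ∫ x, ∫ t in Ioo 0 b, g t x = E b - E 0 := by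
      have : (fun x => ∫ t in Ioo 0 b, g t x) = fun x => Fw b x - Fw 0 x := by
        funext x
        rw [← hFTC b hb x, intervalIntegral.integral_of_le hb.1.le, integral_Ioc_eq_integral_Ioo]
      rw [this, integral_sub (iF b ⟨hb.1.le, hb.2⟩) (iF 0 ⟨le_rfl, hT.le⟩), hEt, hEt]
    rw [intervalIntegral.integral_of_le hb.1.le, integral_Ioc_eq_integral_Ioo]
    simp only [hφt]
    rw [hswap, hx]
    ring
  -- continuity of `E` on `[0, T]`
  have hEcont : ContinuousOn E (Icc 0 T) := by
    have hprim : ContinuousOn (fun b => ∫ t in (0 : ℝ)..b, φ t) (Icc 0 T) := by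
      have h := intervalIntegral.continuousOn_primitive_interval (μ := volume) (f := φ) (a := 0)
        (b := T) (by
          rw [uIcc_of_le hT.le]
          exact (hφ_int.congr_set_ae Ioo_ae_eq_Icc.symm))
      rwa [uIcc_of_le hT.le] at h
    have heq : ∀ b ∈ Icc 0 T, E b = E 0 + ∫ t in (0 : ℝ)..b, φ t := by
      intro b hb
      rcases eq_or_lt_of_le hb.1 with h | h
      · rw [← h]; simp
      · exact hEb b ⟨h, hb.2⟩
    exact (continuousOn_const.add hprim).congr heq
  refine ⟨?_, ?_, fun b hb => ?_⟩
  · refine hφ_int.congr_fun (fun t _ => ?_) measurableSet_Ioo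
    rw [hφt]
    refine integral_congr_ae (Eventually.of_forall fun x => ?_)
    simp only [hgt]
  · rw [hE] at hEcont
    exact hEcont
  · have h := hEb b hb
    rw [hEt', hEt'] at h
    rw [h]
    congr 1
    refine intervalIntegral.integral_congr fun t _ => ?_
    rw [hφt]
    refine integral_congr_ae (Eventually.of_forall fun x => ?_)
    simp only [hgt]

end Summit.NavierStokesRegularity.NavierStokesRegularity.Theorems.RungReynoldsOne

end
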